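import Mathlib
import Summits.Ventures.HodgeRepro.Tier4.Line1.RTFSetting
import Summits.Ventures.HodgeRepro.Tier4.Line1.RtfUnfold
import Summits.Ventures.HodgeRepro.Tier4.Line1.RtfSpectralStep
import Summits.Ventures.HodgeRepro.Tier4.Line1.KernelSupportFinite
import Summits.Ventures.HodgeRepro.Tier4.Line1.KernelUnfold
import Summits.Ventures.HodgeRepro.Tier4.Line1.KernelOperator
import Summits.Ventures.HodgeRepro.Tier4.Line1.KernelOpEqR
import Summits.Ventures.HodgeRepro.Tier4.Line1.KernelEigen
import Summits.Ventures.HodgeRepro.Tier4.Line1.KernelCompact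
import Summits.Ventures.HodgeRepro.Tier4.Line1.InnerCalculus
import Summits.Ventures.HodgeRepro.Tier4.Line1.KernelAdjoint

/-!
# Tier4/Line1/RelClosed — LINE L1, towards J1-(4b): relatively closed invariant subspaces and the relative closure

Blind re-derivation cell `pub-hodge-repro`, Tier 4 «prove the step» (README §9–§10), seat t4-L1-p4 (prover, gen 0;
J1-(4b) `exists_irreducible_invariant_subspace` (Skeleton v0.16 L444, the declared wall) as census + rungs, S12549;
after `InnerCalculus` and `KernelAdjoint`).  Generic Part I over every `RTF.Setting G`, `[SecondCountableTopology G]`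
where the `L²(DG)` Hilbert-space arguments need it; Mathlib + the landed L1 layer only.  Paper: proofs/t4/L1/J1-4b.md.

This module (1 of 4): H-3 `starProjection_comm_of_isSymmetric` / H-4 `starProjection_eigen` (the orthogonal
projection onto a closed `T`-invariant subspace commutes with a symmetric `T` and preserves eigenvectors);
`RelClosed V U` (an invariant subspace of `V` containing `0` and closed under continuous invariant `L²(DG)`-limits,
the closedness clause of (4b)); `eLpNorm_rightTranslate` (the `L²(DG)`-norm of an invariant function is
right-translation invariant); `norm_toLp_sub`, `toLp_R_eq`, `R_invariant`, `continuous_R_of_invariant`;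
`inner_eq_L2`, `toLp_add'`, `toLp_smul'`, `norm_inner_le` (Cauchy–Schwarz); `toLp_mem_closure_iff`; and L1
`relClosed_closure`: the relative closure `{ψ ∈ U | ψ is an L²(DG)-limit of V'}` of an invariant `V'` is relatively
closed invariant.

Nothing here says anything about the status of the Hodge conjecture for CM abelian varieties, which is NOT proved;
HC_CM is NOT proved by anyone in this repository.
-/

set_option autoImplicit false

noncomputable section

namespace Summit.Ventures.HodgeRepro.Tier4.Line1

open MeasureTheory Topology Filter Set
open scoped Uniformity Pointwise InnerProductSpace ComplexConjugate

namespace RTF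

section Hilbert

variable {E : Type} [NormedAddCommGroup E] [InnerProductSpace ℂ E] [CompleteSpace E]

/-- H-3: the orthogonal projection onto a closed subspace `K` invariant under a symmetric `T` commutes
with `T`. -/
theorem starProjection_comm_of_isSymmetric {T : E →L[ℂ] E} (hs : (T : E →ₗ[ℂ] E).IsSymmetric)
    {K : Submodule ℂ E} (hK : IsClosed (K : Set E)) (hinv : ∀ w ∈ K, T w ∈ K) (u : E) :
    haveI : CompleteSpace K := hK.completeSpace_coe
    K.starProjection (T u) = T (K.starProjection u) := by
  haveI : CompleteSpace K := hK.completeSpace_coe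
  apply Submodule.eq_starProjection_of_mem_orthogonal (hinv _ (K.starProjection_apply_mem u))
  rw [Submodule.mem_orthogonal']
  intro w hw
  have h1 : T u - T (K.starProjection u) = T (u - K.starProjection u) := by rw [map_sub]
  rw [h1, hs.apply_clm (u - K.starProjection u) w]
  have h2 : u - K.starProjection u ∈ Kᗮ := K.sub_starProjection_mem_orthogonal u
  exact (Submodule.mem_orthogonal' K _).mp h2 _ (hinv w hw)

/-- H-4: an eigenvector of `T` projects to an eigenvector of `T` (same eigenvalue) on a closed
`T`-invariant subspace. -/
theorem starProjection_eigen {T : E →L[ℂ] E} (hs : (T : E →ₗ[ℂ] E).IsSymmetric)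
    {K : Submodule ℂ E} (hK : IsClosed (K : Set E)) (hinv : ∀ w ∈ K, T w ∈ K) {u : E} {μ : ℂ}
    (hu : T u = μ • u) :
    haveI : CompleteSpace K := hK.completeSpace_coe
    T (K.starProjection u) = μ • K.starProjection u := by
  haveI : CompleteSpace K := hK.completeSpace_coe
  rw [← starProjection_comm_of_isSymmetric hs hK hinv u, hu, map_smul]

end Hilbert

variable {G : Type} [Group G] [TopologicalSpace G] [IsTopologicalGroup G] [MeasurableSpace G]
  [BorelSpace G]

namespace Setting

variable (S : Setting G)


/-- a RELATIVELY CLOSED invariant subspace of `V`: an invariant subspace of continuous invariant functions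
inside `V`, containing `0`, and containing every continuous invariant `L²(DG)`-limit of its members
(the closedness clause of J1-(4b)'s `hclosed`). -/
structure RelClosed (V U : Set (G → ℂ)) : Prop where
  subset : U ⊆ V
  inv : S.IsInvariantSubspace U
  zero_mem : (fun _ : G => (0 : ℂ)) ∈ U
  closed : ∀ ψ : G → ℂ, Continuous ψ → S.Invariant ψ →
    (∀ ε : ℝ, 0 < ε → ∃ ψ' ∈ U,
      eLpNorm (fun x => ψ x - ψ' x) 2 (S.μ.restrict S.DG) < ENNReal.ofReal ε) → ψ ∈ U

/-- the `L²(DG)`-seminorm of a `G(k)`-invariant function is invariant under right translation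
(`IsFundamentalDomain.setLIntegral_eq` between `DG` and `DG · g`). -/
theorem eLpNorm_rightTranslate [Countable S.Gk] {ψ : G → ℂ} (hψ : S.Invariant ψ) (g : G) :
    eLpNorm (fun x => ψ (x * g)) 2 (S.μ.restrict S.DG) = eLpNorm ψ 2 (S.μ.restrict S.DG) := by
  haveI := S.haar
  haveI := S.rightInv
  rw [eLpNorm_eq_lintegral_rpow_enorm_toReal (by norm_num) (by norm_num),
    eLpNorm_eq_lintegral_rpow_enorm_toReal (by norm_num) (by norm_num)]
  congr 1
  set F : G → ENNReal := fun x => ‖ψ x‖ₑ ^ (2 : ENNReal).toReal with hF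
  have hFinv : ∀ (γ : S.Gk) (x : G), F (γ • x) = F x := by
    intro γ x
    simp only [hF, Subgroup.smul_def, smul_eq_mul, hψ γ x]
  have e1 : ∫⁻ x in S.DG, ‖ψ (x * g)‖ₑ ^ (2 : ENNReal).toReal ∂S.μ =
      ∫⁻ y in (fun x => x * g) '' S.DG, F y ∂S.μ := by
    have := (measurePreserving_mul_right S.μ g).setLIntegral_comp_preimage_emb
      (measurableEmbedding_mulRight g) F ((fun x => x * g) '' S.DG)
    have hpre : (fun x => x * g) ⁻¹' ((fun x => x * g) '' S.DG) = S.DG :=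
      (measurableEmbedding_mulRight g).injective.preimage_image S.DG
    rw [hpre] at this
    rw [← this]
  rw [e1]
  exact (S.isFundamentalDomain_mul_right g).setLIntegral_eq S.fdG F hFinv

omit [IsTopologicalGroup G] in
/-- `‖toLp ψ − toLp φ‖ = (eLpNorm (ψ − φ) 2)` for continuous functions. -/
theorem norm_toLp_sub {ψ φ : G → ℂ} (hψ : Continuous ψ) (hφ : Continuous φ) :
    ‖(S.memLp_two_DG hψ).toLp ψ - (S.memLp_two_DG hφ).toLp φ‖ =
      (eLpNorm (fun x => ψ x - φ x) 2 (S.μ.restrict S.DG)).toReal := by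
  rw [← MemLp.toLp_sub, Lp.norm_toLp]
  rfl

/-- the class of `R(f)ψ` is `T_f` applied to the class of `ψ` (continuous invariant `ψ`). -/
theorem toLp_R_eq [SecondCountableTopology G] {f : G → ℂ} (hf : IsTest f)
    (T : Lp ℂ 2 (S.μ.restrict S.DG) →L[ℂ] Lp ℂ 2 (S.μ.restrict S.DG))
    (hT : ∀ ψ : Lp ℂ 2 (S.μ.restrict S.DG), ⇑(T ψ) =ᵐ[S.μ.restrict S.DG] S.kernelOp f ⇑ψ)
    {ψ : G → ℂ} (hψ : S.Invariant ψ) (hψc : Continuous ψ) (hRc : Continuous (S.R f ψ)) :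
    T ((S.memLp_two_DG hψc).toLp ψ) = (S.memLp_two_DG hRc).toLp (S.R f ψ) := by
  apply Lp.ext
  filter_upwards [hT ((S.memLp_two_DG hψc).toLp ψ), MemLp.coeFn_toLp (S.memLp_two_DG hRc)] with x h1 h2
  rw [h1, h2, S.kernelOp_congr_ae f (MemLp.coeFn_toLp (S.memLp_two_DG hψc)),
    S.kernelOp_eq_R hf hψ hψc x]

omit [IsTopologicalGroup G] [BorelSpace G] in
/-- `R(f)ψ` is `G(k)`-invariant for invariant `ψ`. -/
theorem R_invariant (f : G → ℂ) {ψ : G → ℂ} (hψ : S.Invariant ψ) : S.Invariant (S.R f ψ) := by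
  intro γ x
  unfold R
  congr 1
  ext g
  rw [mul_assoc, hψ γ (x * g)]

/-- `R(f)ψ` is continuous for a test function `f` and a continuous invariant `ψ`. -/
theorem continuous_R_of_invariant {f : G → ℂ} (hf : IsTest f) {ψ : G → ℂ} (hψ : S.Invariant ψ)
    (hψc : Continuous ψ) : Continuous (S.R f ψ) := by
  obtain ⟨B, -, hB⟩ := S.exists_bound_of_invariant hψ hψc
  exact S.continuous_R hf hψc hB


omit [IsTopologicalGroup G] in
/-- `S.inner ψ φ = ⟪toLp φ, toLp ψ⟫` for continuous functions. -/
theorem inner_eq_L2 {ψ φ : G → ℂ} (hψ : Continuous ψ) (hφ : Continuous φ) :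
    S.inner ψ φ = ⟪(S.memLp_two_DG hφ).toLp φ, (S.memLp_two_DG hψ).toLp ψ⟫_ℂ :=
  (S.L2_inner_eq (S.memLp_two_DG hφ) (S.memLp_two_DG hψ)).symm

omit [IsTopologicalGroup G] in
/-- `toLp` is additive on continuous functions. -/
theorem toLp_add' {ψ φ : G → ℂ} (hψ : Continuous ψ) (hφ : Continuous φ) :
    (S.memLp_two_DG (hψ.add hφ)).toLp (fun x => ψ x + φ x) =
      (S.memLp_two_DG hψ).toLp ψ + (S.memLp_two_DG hφ).toLp φ := by
  rw [← MemLp.toLp_add]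
  rfl

omit [IsTopologicalGroup G] in
/-- `toLp` is homogeneous on continuous functions. -/
theorem toLp_smul' {ψ : G → ℂ} (hψ : Continuous ψ) (c : ℂ) :
    (S.memLp_two_DG (continuous_const.mul hψ)).toLp (fun x => c * ψ x) =
      c • (S.memLp_two_DG hψ).toLp ψ := by
  rw [← MemLp.toLp_const_smul]
  rfl

omit [IsTopologicalGroup G] in
/-- Cauchy–Schwarz for `S.inner` on continuous functions. -/
theorem norm_inner_le {ψ φ : G → ℂ} (hψ : Continuous ψ) (hφ : Continuous φ) :
    ‖S.inner ψ φ‖ ≤ ‖(S.memLp_two_DG hψ).toLp ψ‖ * ‖(S.memLp_two_DG hφ).toLp φ‖ := by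
  rw [S.inner_eq_L2 hψ hφ, mul_comm]
  exact norm_inner_le_norm _ _

omit [IsTopologicalGroup G] in
/-- the class of a continuous function lies in a closed submodule `K` iff it is an `L²(DG)`-limit of
classes in `K`: membership of the class in the closure of `classes V'` is the approximation property by `V'`. -/
theorem toLp_mem_closure_iff {V' : Set (G → ℂ)} (hV' : S.IsInvariantSubspace V') (hne : V'.Nonempty)
    {ψ : G → ℂ} (hψ : Continuous ψ) :
    (S.memLp_two_DG hψ).toLp ψ ∈ (S.classes V' hV' hne).topologicalClosure ↔
      ∀ ε : ℝ, 0 < ε → ∃ ψ' ∈ V',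
        eLpNorm (fun x => ψ x - ψ' x) 2 (S.μ.restrict S.DG) < ENNReal.ofReal ε := by
  rw [← SetLike.mem_coe, Submodule.topologicalClosure_coe, Metric.mem_closure_iff]
  constructor
  · intro h ε hε
    obtain ⟨u', ⟨ψ', hψ'V, hu'⟩, hd⟩ := h ε hε
    refine ⟨ψ', hψ'V, ?_⟩
    have hψ'c : Continuous ψ' := hV'.cont ψ' hψ'V
    have e : u' = (S.memLp_two_DG hψ'c).toLp ψ' := by
      apply Lp.ext
      filter_upwards [hu', MemLp.coeFn_toLp (S.memLp_two_DG hψ'c)] with x h1 h2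
      rw [h1, h2]
    rw [e, dist_eq_norm, S.norm_toLp_sub hψ hψ'c] at hd
    have hfin : eLpNorm (fun x => ψ x - ψ' x) 2 (S.μ.restrict S.DG) ≠ ⊤ :=
      (S.memLp_two_DG (hψ.sub hψ'c)).eLpNorm_lt_top.ne
    rw [← ENNReal.ofReal_toReal hfin, ENNReal.ofReal_lt_ofReal_iff hε]
    exact hd
  · intro h ε hε
    obtain ⟨ψ', hψ'V, hlt⟩ := h ε hε
    have hψ'c : Continuous ψ' := hV'.cont ψ' hψ'V
    refine ⟨(S.memLp_two_DG hψ'c).toLp ψ', ⟨ψ', hψ'V, MemLp.coeFn_toLp _⟩, ?_⟩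
    rw [dist_eq_norm, S.norm_toLp_sub hψ hψ'c]
    have hfin : eLpNorm (fun x => ψ x - ψ' x) 2 (S.μ.restrict S.DG) ≠ ⊤ :=
      (S.memLp_two_DG (hψ.sub hψ'c)).eLpNorm_lt_top.ne
    rw [← ENNReal.ofReal_toReal hfin, ENNReal.ofReal_lt_ofReal_iff hε] at hlt
    exact hlt

/-- L1: the relative closure `U₁ := {ψ ∈ U | toLp ψ ∈ cl(classes V')}` of an invariant `V' ⊆ U` is a
relatively closed invariant subspace of `V` (right translation by the unitarity of the `L²(DG)`-norm,
`R(f)` by `kernelCLM_mapsTo_closure`). -/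
theorem relClosed_closure [SecondCountableTopology G] {V U : Set (G → ℂ)} (hU : S.RelClosed V U)
    {V' : Set (G → ℂ)} (hV' : S.IsInvariantSubspace V') (hne : V'.Nonempty) :
    S.RelClosed V {ψ | ψ ∈ U ∧ ∀ ε : ℝ, 0 < ε → ∃ ψ' ∈ V',
      eLpNorm (fun x => ψ x - ψ' x) 2 (S.μ.restrict S.DG) < ENNReal.ofReal ε} := by
  haveI : Countable S.Gk := S.countable_Gk
  refine ⟨fun ψ hψ => hU.subset hψ.1, ?_, ?_, ?_⟩
  · refine ⟨fun ψ hψ => hU.inv.inv ψ hψ.1, fun ψ hψ => hU.inv.cont ψ hψ.1, ?_, ?_, ?_, ?_⟩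
    · -- right translation
      rintro ψ ⟨hψU, happ⟩ g
      refine ⟨hU.inv.right ψ hψU g, fun ε hε => ?_⟩
      obtain ⟨ψ', hψ'V, hlt⟩ := happ ε hε
      refine ⟨fun x => ψ' (x * g), hV'.right ψ' hψ'V g, ?_⟩
      have hinv : S.Invariant fun x => ψ x - ψ' x := fun γ x => by
        simp only [hU.inv.inv ψ hψU γ x, hV'.inv ψ' hψ'V γ x]
      rw [show (fun x => ψ (x * g) - ψ' (x * g)) = fun x => (fun y => ψ y - ψ' y) (x * g) from rfl,
        S.eLpNorm_rightTranslate hinv g]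
      exact hlt
    · -- addition
      rintro ψ ⟨hψU, happ⟩ φ ⟨hφU, happ'⟩
      refine ⟨hU.inv.add ψ hψU φ hφU, fun ε hε => ?_⟩
      obtain ⟨ψ', hψ'V, h1⟩ := happ (ε / 2) (by positivity)
      obtain ⟨φ', hφ'V, h2⟩ := happ' (ε / 2) (by positivity)
      refine ⟨fun x => ψ' x + φ' x, hV'.add ψ' hψ'V φ' hφ'V, ?_⟩
      have hψc := hU.inv.cont ψ hψU
      have hφc := hU.inv.cont φ hφU
      have hψ'c := hV'.cont ψ' hψ'V
      have hφ'c := hV'.cont φ' hφ'V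
      have e : (fun x => ψ x + φ x - (ψ' x + φ' x)) =
          fun x => (ψ x - ψ' x) + (φ x - φ' x) := by ext x; ring
      rw [e]
      calc eLpNorm (fun x => (ψ x - ψ' x) + (φ x - φ' x)) 2 (S.μ.restrict S.DG)
          ≤ eLpNorm (fun x => ψ x - ψ' x) 2 (S.μ.restrict S.DG) +
            eLpNorm (fun x => φ x - φ' x) 2 (S.μ.restrict S.DG) :=
            eLpNorm_add_le (hψc.sub hψ'c).aestronglyMeasurable (hφc.sub hφ'c).aestronglyMeasurable
              (by norm_num)
        _ < ENNReal.ofReal (ε / 2) + ENNReal.ofReal (ε / 2) :=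
            ENNReal.add_lt_add h1 h2
        _ = ENNReal.ofReal ε := by
            rw [← ENNReal.ofReal_add (by positivity) (by positivity)]
            congr 1
            ring
    · -- scalar multiplication
      rintro ψ ⟨hψU, happ⟩ c
      refine ⟨hU.inv.smul ψ hψU c, fun ε hε => ?_⟩
      obtain ⟨ψ', hψ'V, h1⟩ := happ (ε / (‖c‖ + 1)) (by positivity)
      refine ⟨fun x => c * ψ' x, hV'.smul ψ' hψ'V c, ?_⟩
      have e : (fun x => c * ψ x - c * ψ' x) = fun x => c * (ψ x - ψ' x) := by ext x; ring
      rw [e]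
      calc eLpNorm (fun x => c * (ψ x - ψ' x)) 2 (S.μ.restrict S.DG)
          = ‖c‖ₑ * eLpNorm (fun x => ψ x - ψ' x) 2 (S.μ.restrict S.DG) := by
            rw [show (fun x => c * (ψ x - ψ' x)) = c • (fun x => ψ x - ψ' x) from rfl]
            exact eLpNorm_const_smul c _ 2 _
        _ ≤ ‖c‖ₑ * ENNReal.ofReal (ε / (‖c‖ + 1)) := by gcongr
        _ = ENNReal.ofReal (‖c‖ * (ε / (‖c‖ + 1))) := by
            rw [ENNReal.ofReal_mul (norm_nonneg c), ofReal_norm]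
        _ < ENNReal.ofReal ε := by
            rw [ENNReal.ofReal_lt_ofReal_iff hε]
            have hc0 : 0 ≤ ‖c‖ := norm_nonneg c
            rw [mul_div_assoc', div_lt_iff₀ (by positivity)]
            nlinarith
    · -- `R(f)`
      rintro ψ ⟨hψU, happ⟩ f hf
      refine ⟨hU.inv.conv ψ hψU f hf, ?_⟩
      have hψc := hU.inv.cont ψ hψU
      have hψinv := hU.inv.inv ψ hψU
      rw [← S.toLp_mem_closure_iff hV' hne (S.continuous_R_of_invariant hf hψinv hψc)]
      obtain ⟨T, hT⟩ := S.exists_kernelCLM hf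
      rw [← S.toLp_R_eq hf T hT hψinv hψc (S.continuous_R_of_invariant hf hψinv hψc)]
      apply S.kernelCLM_mapsTo_closure hV' hne hf T hT
      exact (S.toLp_mem_closure_iff hV' hne hψc).mpr happ
  · refine ⟨hU.zero_mem, fun ε hε => ?_⟩
    obtain ⟨φ, hφ⟩ := hne
    refine ⟨fun x => (0 : ℂ) * φ x, hV'.smul φ hφ 0, ?_⟩
    simp only [zero_mul, sub_zero]
    rw [show (fun _ : G => (0 : ℂ)) = (0 : G → ℂ) from rfl, eLpNorm_zero]
    exact ENNReal.ofReal_pos.mpr hε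
  · -- closedness
    intro ψ hψc hψinv happ
    refine ⟨hU.closed ψ hψc hψinv fun ε hε => ?_, fun ε hε => ?_⟩
    · obtain ⟨ψ', ⟨hψ'U, -⟩, hlt⟩ := happ ε hε
      exact ⟨ψ', hψ'U, hlt⟩
    · obtain ⟨ψ', ⟨hψ'U, happ'⟩, h1⟩ := happ (ε / 2) (by positivity)
      obtain ⟨ψ'', hψ''V, h2⟩ := happ' (ε / 2) (by positivity)
      refine ⟨ψ'', hψ''V, ?_⟩
      have hψ'c := hU.inv.cont ψ' hψ'U
      have hψ''c := hV'.cont ψ'' hψ''V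
      have e : (fun x => ψ x - ψ'' x) = fun x => (ψ x - ψ' x) + (ψ' x - ψ'' x) := by ext x; ring
      rw [e]
      calc eLpNorm (fun x => (ψ x - ψ' x) + (ψ' x - ψ'' x)) 2 (S.μ.restrict S.DG)
          ≤ eLpNorm (fun x => ψ x - ψ' x) 2 (S.μ.restrict S.DG) +
            eLpNorm (fun x => ψ' x - ψ'' x) 2 (S.μ.restrict S.DG) :=
            eLpNorm_add_le (hψc.sub hψ'c).aestronglyMeasurable (hψ'c.sub hψ''c).aestronglyMeasurable
              (by norm_num)
        _ < ENNReal.ofReal (ε / 2) + ENNReal.ofReal (ε / 2) := ENNReal.add_lt_add h1 h2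
        _ = ENNReal.ofReal ε := by
            rw [← ENNReal.ofReal_add (by positivity) (by positivity)]
            congr 1
            ring

end Setting

end RTF

end Summit.Ventures.HodgeRepro.Tier4.Line1
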